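import Summits.CriticalPhenomena.SAWScalingLimit.Theorems.SAWRenewalTightnessSubseqIdentificationTiltedBracketFrozen
import HarnessLib

/-!
# The tilted martingale identities (line `boundary-area-law`, RS5b′/T2, Σ): the frozen second moment

Line `boundary-area-law` of the crux `SubseqIdentification` (stmt-CriticalPhenomena-0783), restriction
reshape (lead c4, r-c4-5), stub `stub_tiltedBracketMartingale` (Σ) = the bracket half of step (T2) of
the tilted [LSW] Theorem 6.5 (G. F. Lawler, O. Schramm, W. Werner, *Conformal restriction: the chordal
case*, J. Amer. Math. Soc. **16** (2003), §5 (5.1)–(5.3) and Prop. 5.3). Sequel of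
`…TiltedBracketFrozen`: the conditional second moment of the mixed term is the tilted clock,

  `E_{ω₂}[(ΔW̃ · Ŷ′_{α′,λ′})²] = κ (d · d^{α′})² h + O(h√h)`

uniformly on the controlled class, with a constant quadratic in the envelope level
(`exists_abs_integral_frozenBrk_sq_le`): the square is expanded around the `O(h)` shift
`s = 6α′ d^{α′} c₂ h` (second conjunct of `frozenBrk_moments`), the cross term `2s E[Z] − s²` being `O(h²)` by
the first moment (first conjunct), and the one-step constants are uniform on the class
(`imageStepC_le_of_abs_le`, `imageStepC₂_le_of_abs_le`). With `(α′, λ′) = (α/2, λ/2)`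
(`Ŷ′_{α/2,λ/2}² = Ŷ′_{α,λ}`) this is the one-step form of "`d⟨W̃⟩ = κ h′(W)² dt`, multiplied by `Y`"
(sequel `…TiltedBracketInterior`).

References: [LSW] §5 (5.1)–(5.3), Prop. 5.3. No named fact is used.
-/

noncomputable section

open MeasureTheory Filter Topology Set Metric Function
open scoped NNReal ENNReal
open Literature.Probability.RandomPlanarGeometry
open Literature.Probability.Process (preWienerMeasure runSup runSup_nonneg integrable_runSup integrable_runSup_sq)

namespace Summit.CriticalPhenomena.SAWScalingLimit.Theorems.SubseqIdentification.BoundaryAreaLaw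

open Loewner PathOps

variable [MeasurableSpace C(ℝ≥0, ℝ)] [BorelSpace C(ℝ≥0, ℝ)]
variable {κ : ℝ≥0} {α lam : ℝ} {A : Set ℂ}

/-! ### The frozen second moment, uniform form -/

section Moment

-- the two frozen moments, their integrability and the expansion of the square in ONE proof need slightly more
-- than the default heartbeats (each piece elaborates quickly; the total is about 3·10⁵)
set_option maxHeartbeats 400000 in
/-- **The frozen second moment of the mixed term, uniform form** ([LSW] §5, one step, conditionally on
the past): for `0 < κ ≤ 8/3`, `A ⊆ B̄(0, R)`, class constants `δ₀ > 0`, `0 < ρ₀ ≤ 1` and exponents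
`α′ > 0`, `λ′ ≥ 0` there is `K ≥ 0` with: for every past `ω` alive at `u` with `2δ₀ ≤ Φ′_{A_u − W_u}(0)`,
`B(0, 16ρ₀)` off `A_u − W_u`, `|W| ≤ N` on `[0, u]`, and every step `0 < h ≤ 3c₀²/256`, `λ′ h M_m ≤ 1`,

  `|E_{ω₂}[(ΔW̃ · Ŷ′_{α′,λ′})²] − κ (d · d^{α′})² h| ≤ K (1 + (M₀ + 6α′/ρ₀)²) · h√h`

(`d = Φ′_{A_u−W_u}(0)`, `M₀ = 3482N + 15080√(u+h) + 1160R`): expand the square around the shift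
`s = 6α′d^{α′}c₂h = O(h)` (`frozenBrk_moments`), the cross term `2s E[Z] − s²` being `O(h²)` by the first
moment; the one-step constants are uniform on the class
(`imageStepC_le_of_abs_le`, `imageStepC₂_le_of_abs_le`). [cite: LawlerSchrammWerner2003Restriction, §5 (5.1)–(5.3) and Prop. 5.3] -/
theorem exists_abs_integral_frozenBrk_sq_le (hκ0 : 0 < κ) (hκ : κ ≤ 8 / 3) (hA : IsStarHull A) (hne : A.Nonempty)
    {R : ℝ} (hR0 : 0 < R) (hAR : A ⊆ closedBall (0 : ℂ) R) {δ₀ ρ₀ : ℝ} (hδ0 : 0 < δ₀) (hρ₀ : 0 < ρ₀) (hρ1 : ρ₀ ≤ 1)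
    {α' lam' : ℝ} (hα' : 0 < α') (hlam' : 0 ≤ lam') :
    ∃ K : ℝ, 0 ≤ K ∧ ∀ {u h : ℝ≥0} {ω : ℝ≥0 → ℝ} {N : ℝ},
      Disjoint (closedHull (drvK κ (brownianCPath ω)) u) A →
      Disjoint (ball (0 : ℂ) (16 * ρ₀)) (slidHull (drvK κ (brownianCPath ω)) A u) →
      2 * δ₀ ≤ starDeriv (slidHull (drvK κ (brownianCPath ω)) A u) → 0 < h →
      (h : ℝ) ≤ 3 * (δ₀ * ρ₀ / 4000) ^ 2 / 256 → 0 ≤ N → (∀ s : ℝ≥0, s ≤ u → |drvK κ (brownianCPath ω) s| ≤ N) →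
      lam' * (h * massBound δ₀ ρ₀) ≤ 1 →
      |∫ ω₂, ((imageDrvFnK κ A (u + h) (concat u (stop u (brownianCPath ω), brownianCPath ω₂)) -
              imageDrvFnK κ A u (concat u (stop u (brownianCPath ω), brownianCPath ω₂))) *
            (DFnK κ A (u + h) (concat u (stop u (brownianCPath ω), brownianCPath ω₂)) ^ α' *
              Real.exp (-(lam' * JFnK κ A u h (concat u (stop u (brownianCPath ω), brownianCPath ω₂)))))) ^ 2
            ∂preWienerMeasure -
          κ * (starDeriv (slidHull (drvK κ (brownianCPath ω)) A u) * starDeriv (slidHull (drvK κ (brownianCPath ω)) A u) ^ α') ^ 2 * h| ≤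
        K * (1 + ((3482 * N + (15080 * Real.sqrt ((u + h : ℝ≥0) : ℝ) + 1160 * R)) + 6 * α' / ρ₀) ^ 2) * h * Real.sqrt h := by
  haveI := isProbabilityMeasure_preWienerMeasure'
  have hκ' : (0 : ℝ) < κ := by exact_mod_cast hκ0
  have hκr : (0 : ℝ) ≤ κ := κ.coe_nonneg
  have hsκ : 0 < Real.sqrt κ := Real.sqrt_pos.2 hκ'
  have hσ := stepSigma_pos
  have hK₁ : 0 ≤ stepK δ₀ ρ₀ := by rw [stepK]; positivity
  have hcompK0 : 0 ≤ compK α' lam' δ₀ ρ₀ := (compK_pos hα' hlam' hδ0 hρ₀).le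
  have hK₂ : 0 ≤ compK α' lam' δ₀ ρ₀ * (stepSigma / Real.sqrt κ) := by positivity
  obtain ⟨K₀, hK₀0, hK₀⟩ := exists_abs_prod_sub_model_le hα' hlam' hδ0 hρ₀ hK₁ hK₂
  -- the uniform constants (functions of `κ, α′, δ₀, ρ₀, K₀` only)
  obtain ⟨p, hp⟩ : ∃ p : ℝ, p = 128 * (κ : ℝ) ^ 2 / (δ₀ * ρ₀ / 4000 * (Real.sqrt κ / stepSigma)) ^ 4 := ⟨_, rfl⟩
  obtain ⟨j, hj⟩ : ∃ j : ℝ, j = (1 + 2 * α') / ρ₀ := ⟨_, rfl⟩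
  obtain ⟨a, ha⟩ : ∃ a : ℝ, a = 6 * α' / ρ₀ := ⟨_, rfl⟩
  obtain ⟨q, hq⟩ : ∃ q : ℝ, q = |(κ : ℝ) / 2 - 3 + κ * α'| / ρ₀ := ⟨_, rfl⟩
  obtain ⟨A₁, hA₁⟩ : ∃ A₁ : ℝ, A₁ = K₀ * (3 * Real.sqrt κ + 5 + 2 * κ * Real.sqrt κ) + 3 * j * p +
    2 * (3482 * Real.sqrt κ) * Real.sqrt p + Real.sqrt κ * Real.sqrt p + j * κ * Real.sqrt p := ⟨_, rfl⟩
  obtain ⟨A₂, hA₂⟩ : ∃ A₂ : ℝ, A₂ = 2 * (7 * K₀ + 3 * j) ^ 2 + 6 * (K₀ + j / 2) ^ 2 * κ ^ 2 + 2 * (7 * K₀ + 3 * j) * Real.sqrt κ +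
    4 * (K₀ + j / 2) * κ * Real.sqrt κ + 10 * (3482 * Real.sqrt κ) ^ 2 * Real.sqrt p + 2 * κ * Real.sqrt p := ⟨_, rfl⟩
  have hp0 : 0 ≤ p := by rw [hp]; positivity
  have hj0 : 0 ≤ j := by rw [hj]; positivity
  have ha0 : 0 ≤ a := by rw [ha]; positivity
  have hq0 : 0 ≤ q := by rw [hq]; positivity
  have hA₁0 : 0 ≤ A₁ := by rw [hA₁]; positivity
  have hA₂0 : 0 ≤ A₂ := by rw [hA₂]; positivity
  refine ⟨A₂ + 2 * a * A₁ + 2 * a * q + a ^ 2 + 2 * a * p + 2 * p, by positivity, ?_⟩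
  intro u h ω N halive hBρ hδ hh0 hh hN0 hN hlamh
  have hh0' : (0 : ℝ) ≤ h := h.coe_nonneg
  have hh1 : (h : ℝ) ≤ 1 := by
    have hδ1 : δ₀ ≤ 1 := by linarith [(starDeriv_pos_le_one (slidHull (drvK κ (brownianCPath ω)) A u)).2]
    have h0 : 0 ≤ δ₀ * ρ₀ / 4000 := by positivity
    have h1' : δ₀ * ρ₀ / 4000 ≤ 1 := by
      rw [div_le_one (by norm_num)]; nlinarith [mul_le_mul hδ1 hρ1 hρ₀.le zero_le_one]
    nlinarith [mul_le_one₀ h1' h0 h1']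
  have hhs0 : 0 ≤ (h : ℝ) * Real.sqrt h := by positivity
  have hh2 : (h : ℝ) ^ 2 ≤ h * Real.sqrt h := by
    have hhs : (h : ℝ) ≤ Real.sqrt h := by rw [Real.le_sqrt hh0' hh0']; nlinarith
    nlinarith
  set B := slidHull (drvK κ (brownianCPath ω)) A u with hBdef
  have hB : IsStarHull B := Loewner.isStarHull_slidHull_of_disjoint (continuous_drvK κ _) hA halive
  have hBρ8 : Disjoint (ball (0 : ℂ) (8 * ρ₀)) B := hBρ.mono_left (ball_subset_ball (by linarith))
  obtain ⟨hd0, hd1, -⟩ := starDeriv_spec hB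
  obtain ⟨-, -, hc2, -, -⟩ := starJet_spec hB hρ₀ hBρ8
  set d : ℝ := starDeriv B with hd
  set c₂ : ℝ := starJet2 B with hc₂
  have hy0 : 0 ≤ d ^ α' := Real.rpow_nonneg hd0.le _
  have hy1 : d ^ α' ≤ 1 := Real.rpow_le_one hd0.le hd1 hα'.le
  set s : ℝ := 6 * α' * d ^ α' * c₂ * h with hs
  set M₀ : ℝ := (3482 * N + (15080 * Real.sqrt ((u + h : ℝ≥0) : ℝ) + 1160 * R)) + 6 * α' / ρ₀ with hM₀
  have hM₀0 : 0 ≤ M₀ := by positivity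
  set Z : (ℝ≥0 → ℝ) → ℝ := fun ω₂ ↦ (imageDrvFnK κ A (u + h) (concat u (stop u (brownianCPath ω), brownianCPath ω₂)) -
      imageDrvFnK κ A u (concat u (stop u (brownianCPath ω), brownianCPath ω₂))) *
    (DFnK κ A (u + h) (concat u (stop u (brownianCPath ω), brownianCPath ω₂)) ^ α' *
      Real.exp (-(lam' * JFnK κ A u h (concat u (stop u (brownianCPath ω), brownianCPath ω₂))))) with hZ
  -- the two frozen moments and the integrability of `Z`, `(Z − s)²`
  obtain ⟨fm, sq, iZ, iZs2⟩ :=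
    frozenBrk_moments hκ0 hκ hA hne hR0 hAR halive hρ₀ hρ1 hBρ hδ0 hδ hh0 hh hN0 hN hα' hlam' hlamh hK₀0 hK₀
  replace sq : |∫ ω₂, (Z ω₂ - s) ^ 2 ∂preWienerMeasure - κ * (d * d ^ α') ^ 2 * h| ≤
      imageStepC₂ κ (δ₀ * ρ₀ / 4000 * (Real.sqrt κ / stepSigma)) (d * d ^ α') (d ^ α' * c₂ * (1 + 2 * α')) K₀ M₀
        (3482 * Real.sqrt κ) * h * Real.sqrt h := sq
  replace fm : |∫ ω₂, Z ω₂ ∂preWienerMeasure - h * (d ^ α' * c₂ * ((κ : ℝ) / 2 - 3 + κ * α'))| ≤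
      imageStepC κ (δ₀ * ρ₀ / 4000 * (Real.sqrt κ / stepSigma)) (d * d ^ α') (d ^ α' * c₂ * (1 + 2 * α')) K₀ M₀
        (3482 * Real.sqrt κ) * h * Real.sqrt h := fm
  replace iZ : Integrable Z preWienerMeasure := iZ
  replace iZs2 : Integrable (fun ω₂ ↦ (Z ω₂ - s) ^ 2) preWienerMeasure := iZs2
  -- uniformity of the one-step constants on the class
  have hd' : |d * d ^ α'| ≤ 1 := by rw [abs_mul, abs_of_pos hd0, abs_of_nonneg hy0]; exact mul_le_one₀ hd1 hy0 hy1
  have hc₂' : |d ^ α' * c₂ * (1 + 2 * α')| ≤ j := by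
    rw [abs_mul, abs_mul, abs_of_nonneg hy0, abs_of_nonneg (by positivity : (0 : ℝ) ≤ 1 + 2 * α'), hj]
    calc d ^ α' * |c₂| * (1 + 2 * α') ≤ 1 * (1 / ρ₀) * (1 + 2 * α') :=
          mul_le_mul_of_nonneg_right (mul_le_mul hy1 hc2 (abs_nonneg _) zero_le_one) (by positivity)
      _ = (1 + 2 * α') / ρ₀ := by ring
  have m1 : imageStepC κ (δ₀ * ρ₀ / 4000 * (Real.sqrt κ / stepSigma)) (d * d ^ α') (d ^ α' * c₂ * (1 + 2 * α')) K₀ M₀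
      (3482 * Real.sqrt κ) ≤ A₁ + p * M₀ := by
    have := imageStepC_le_of_abs_le (κ := (κ : ℝ)) (c := δ₀ * ρ₀ / 4000 * (Real.sqrt κ / stepSigma)) (K := K₀) (M₀ := M₀)
      (M₁ := 3482 * Real.sqrt κ) hκr hd' hc₂'
    rw [hA₁, hp]; exact this
  have m2 : imageStepC₂ κ (δ₀ * ρ₀ / 4000 * (Real.sqrt κ / stepSigma)) (d * d ^ α') (d ^ α' * c₂ * (1 + 2 * α')) K₀ M₀
      (3482 * Real.sqrt κ) ≤ A₂ + 2 * p * M₀ ^ 2 := by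
    have := imageStepC₂_le_of_abs_le (κ := (κ : ℝ)) (c := δ₀ * ρ₀ / 4000 * (Real.sqrt κ / stepSigma)) (K := K₀) (M₀ := M₀)
      (M₁ := 3482 * Real.sqrt κ) hκr hK₀0 hd' hc₂'
    rw [hA₂, hp]; exact this
  -- sizes of the shift and of the drift coefficient
  have hss : |s| ≤ a * h := by rw [ha]; exact abs_brkShift_le α' ρ₀ (d ^ α') c₂ h hα' hρ₀ hy0 hy1 hc2 hh0'
  have hcoef : |(h : ℝ) * (d ^ α' * c₂ * ((κ : ℝ) / 2 - 3 + κ * α'))| ≤ q * h := by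
    rw [abs_mul, abs_of_nonneg hh0', abs_mul, abs_mul, abs_of_nonneg hy0, hq]
    have : d ^ α' * |c₂| * |(κ : ℝ) / 2 - 3 + κ * α'| ≤ 1 * (1 / ρ₀) * |(κ : ℝ) / 2 - 3 + κ * α'| :=
      mul_le_mul_of_nonneg_right (mul_le_mul hy1 hc2 (abs_nonneg _) zero_le_one) (abs_nonneg _)
    calc _ ≤ (h : ℝ) * (1 * (1 / ρ₀) * |(κ : ℝ) / 2 - 3 + κ * α'|) := mul_le_mul_of_nonneg_left this hh0'
      _ = _ := by ring
  -- `∫ Z² = ∫ (Z − s)² + 2s ∫ Z − s²`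
  have i2 : Integrable (fun ω₂ ↦ 2 * s * Z ω₂) preWienerMeasure := iZ.const_mul (2 * s)
  have i12 : Integrable (fun ω₂ ↦ (Z ω₂ - s) ^ 2 + 2 * s * Z ω₂) preWienerMeasure := iZs2.add i2
  have hexp : ∫ ω₂, Z ω₂ ^ 2 ∂preWienerMeasure =
      ∫ ω₂, (Z ω₂ - s) ^ 2 ∂preWienerMeasure + 2 * s * ∫ ω₂, Z ω₂ ∂preWienerMeasure - s ^ 2 := by
    have e : (fun ω₂ ↦ Z ω₂ ^ 2) = fun ω₂ ↦ ((Z ω₂ - s) ^ 2 + 2 * s * Z ω₂) - s ^ 2 := by funext ω₂; ring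
    rw [e, integral_sub i12 (integrable_const _), integral_add iZs2 i2, integral_const_mul, integral_const]
    simp
  -- assemble
  have key : ∫ ω₂, Z ω₂ ^ 2 ∂preWienerMeasure - κ * (d * d ^ α') ^ 2 * h =
      (∫ ω₂, (Z ω₂ - s) ^ 2 ∂preWienerMeasure - κ * (d * d ^ α') ^ 2 * h) +
        2 * s * (∫ ω₂, Z ω₂ ∂preWienerMeasure - h * (d ^ α' * c₂ * ((κ : ℝ) / 2 - 3 + κ * α'))) +
        (2 * s * (h * (d ^ α' * c₂ * ((κ : ℝ) / 2 - 3 + κ * α'))) - s ^ 2) := by rw [hexp]; ring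
  have t2 : |2 * s * (∫ ω₂, Z ω₂ ∂preWienerMeasure - h * (d ^ α' * c₂ * ((κ : ℝ) / 2 - 3 + κ * α')))| ≤
      2 * (a * h) * ((A₁ + p * M₀) * h * Real.sqrt h) := by
    rw [abs_mul, abs_mul, abs_two]
    refine mul_le_mul (mul_le_mul_of_nonneg_left hss zero_le_two) (fm.trans ?_) (abs_nonneg _) (by positivity)
    exact mul_le_mul_of_nonneg_right (mul_le_mul_of_nonneg_right m1 hh0') (Real.sqrt_nonneg _)
  have t3 : |2 * s * (h * (d ^ α' * c₂ * ((κ : ℝ) / 2 - 3 + κ * α'))) - s ^ 2| ≤ 2 * (a * h) * (q * h) + (a * h) ^ 2 := by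
    refine (abs_sub _ _).trans (add_le_add ?_ ?_)
    · rw [abs_mul, abs_mul, abs_two]
      exact mul_le_mul (mul_le_mul_of_nonneg_left hss zero_le_two) hcoef (abs_nonneg _) (by positivity)
    · rw [abs_of_nonneg (sq_nonneg _), ← sq_abs]; exact pow_le_pow_left₀ (abs_nonneg _) hss 2
  have t1 : |∫ ω₂, (Z ω₂ - s) ^ 2 ∂preWienerMeasure - κ * (d * d ^ α') ^ 2 * h| ≤ (A₂ + 2 * p * M₀ ^ 2) * h * Real.sqrt h :=
    sq.trans (mul_le_mul_of_nonneg_right (mul_le_mul_of_nonneg_right m2 hh0') (Real.sqrt_nonneg _))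
  show |∫ ω₂, Z ω₂ ^ 2 ∂preWienerMeasure - κ * (d * d ^ α') ^ 2 * h| ≤
    (A₂ + 2 * a * A₁ + 2 * a * q + a ^ 2 + 2 * a * p + 2 * p) * (1 + M₀ ^ 2) * h * Real.sqrt h
  rw [key]
  refine (abs_add_le _ _).trans ((add_le_add ((abs_add_le _ _).trans (add_le_add t1 t2)) t3).trans ?_)
  -- elementary arithmetic with `h ≤ 1`, `h² ≤ h√h`, `M₀ ≤ 1 + M₀²`
  have e1 : 2 * (a * h) * ((A₁ + p * M₀) * h * Real.sqrt h) ≤ 2 * a * (A₁ + p * M₀) * (h * Real.sqrt h) := by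
    have : 2 * (a * h) * ((A₁ + p * M₀) * h * Real.sqrt h) = h * (2 * a * (A₁ + p * M₀) * (h * Real.sqrt h)) := by ring
    rw [this]
    exact (mul_le_of_le_one_left (by positivity) hh1)
  have e2 : 2 * (a * h) * (q * h) + (a * h) ^ 2 ≤ (2 * a * q + a ^ 2) * (h * Real.sqrt h) := by
    have : 2 * (a * h) * (q * h) + (a * h) ^ 2 = (2 * a * q + a ^ 2) * h ^ 2 := by ring
    rw [this]; exact mul_le_mul_of_nonneg_left hh2 (by positivity)
  have e4 : (A₂ + 2 * p * M₀ ^ 2) * h * Real.sqrt h + 2 * a * (A₁ + p * M₀) * (h * Real.sqrt h) +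
      (2 * a * q + a ^ 2) * (h * Real.sqrt h) ≤
      (A₂ + 2 * a * A₁ + 2 * a * q + a ^ 2 + 2 * a * p + 2 * p) * (1 + M₀ ^ 2) * h * Real.sqrt h := by
    have f1 : (A₂ + 2 * p * M₀ ^ 2) + 2 * a * (A₁ + p * M₀) + (2 * a * q + a ^ 2) ≤
        (A₂ + 2 * a * A₁ + 2 * a * q + a ^ 2 + 2 * a * p + 2 * p) * (1 + M₀ ^ 2) := by
      have g1 : (A₂ + 2 * a * A₁ + 2 * a * q + a ^ 2 + 2 * a * p + 2 * p) * (1 + M₀ ^ 2) -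
          ((A₂ + 2 * p * M₀ ^ 2) + 2 * a * (A₁ + p * M₀) + (2 * a * q + a ^ 2)) =
          2 * p + (A₂ + 2 * a * A₁ + 2 * a * q + a ^ 2) * M₀ ^ 2 + 2 * a * p * ((M₀ - 1 / 2) ^ 2 + 3 / 4) := by ring
      have g2 : 0 ≤ (A₂ + 2 * a * A₁ + 2 * a * q + a ^ 2) * M₀ ^ 2 := by positivity
      have g3 : 0 ≤ 2 * a * p * ((M₀ - 1 / 2) ^ 2 + 3 / 4) := by positivity
      linarith
    have := mul_le_mul_of_nonneg_right f1 hhs0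
    have e : (A₂ + 2 * p * M₀ ^ 2) * h * Real.sqrt h + 2 * a * (A₁ + p * M₀) * (h * Real.sqrt h) +
        (2 * a * q + a ^ 2) * (h * Real.sqrt h) =
        ((A₂ + 2 * p * M₀ ^ 2) + 2 * a * (A₁ + p * M₀) + (2 * a * q + a ^ 2)) * (h * Real.sqrt h) := by ring
    rw [e]; linarith
  linarith [e1, e2, e4]

end Moment

section Registered

omit [MeasurableSpace C(ℝ≥0, ℝ)] [BorelSpace C(ℝ≥0, ℝ)] in
/-- **Registered form** (explicit binders) of `exists_abs_integral_frozenBrk_sq_le`: the frozen second moment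
of `ΔW̃ · Ŷ′_{α′,λ′}` is `κ (d·d^{α′})² h + O(h√h)` uniformly on the controlled class, with a constant
quadratic in the envelope level. [cite: LawlerSchrammWerner2003Restriction, §5 (5.1)–(5.3) and Prop. 5.3] -/
theorem exists_abs_integral_frozenBrk_sq_le_registered :
    ∀ (κ : ℝ≥0), 0 < κ → κ ≤ 8 / 3 → ∀ (A : Set ℂ), IsStarHull A → A.Nonempty → ∀ (R : ℝ), 0 < R →
      A ⊆ closedBall (0 : ℂ) R → ∀ (δ₀ ρ₀ : ℝ), 0 < δ₀ → 0 < ρ₀ → ρ₀ ≤ 1 → ∀ (α' lam' : ℝ), 0 < α' → 0 ≤ lam' →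
      ∃ K : ℝ, 0 ≤ K ∧ ∀ (u h : ℝ≥0) (ω : ℝ≥0 → ℝ) (N : ℝ),
        Disjoint (closedHull (drvK κ (brownianCPath ω)) u) A →
        Disjoint (ball (0 : ℂ) (16 * ρ₀)) (Loewner.slidHull (drvK κ (brownianCPath ω)) A u) →
        2 * δ₀ ≤ starDeriv (Loewner.slidHull (drvK κ (brownianCPath ω)) A u) → 0 < h →
        (h : ℝ) ≤ 3 * (δ₀ * ρ₀ / 4000) ^ 2 / 256 → 0 ≤ N → (∀ s : ℝ≥0, s ≤ u → |drvK κ (brownianCPath ω) s| ≤ N) →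
        lam' * (h * massBound δ₀ ρ₀) ≤ 1 →
        |∫ ω₂, ((imageDrvFnK κ A (u + h) (PathOps.concat u (PathOps.stop u (brownianCPath ω), brownianCPath ω₂)) -
                imageDrvFnK κ A u (PathOps.concat u (PathOps.stop u (brownianCPath ω), brownianCPath ω₂))) *
              (DFnK κ A (u + h) (PathOps.concat u (PathOps.stop u (brownianCPath ω), brownianCPath ω₂)) ^ α' *
                Real.exp (-(lam' * JFnK κ A u h (PathOps.concat u (PathOps.stop u (brownianCPath ω), brownianCPath ω₂)))))) ^ 2
              ∂preWienerMeasure -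
            κ * (starDeriv (Loewner.slidHull (drvK κ (brownianCPath ω)) A u) *
              starDeriv (Loewner.slidHull (drvK κ (brownianCPath ω)) A u) ^ α') ^ 2 * h| ≤
          K * (1 + ((3482 * N + (15080 * Real.sqrt ((u + h : ℝ≥0) : ℝ) + 1160 * R)) + 6 * α' / ρ₀) ^ 2) * h * Real.sqrt h := by
  intro κ hκ0 hκ A hA hne R hR0 hAR δ₀ ρ₀ hδ0 hρ₀ hρ1 α' lam' hα' hlam'
  letI : MeasurableSpace C(ℝ≥0, ℝ) := borel _
  haveI : BorelSpace C(ℝ≥0, ℝ) := ⟨rfl⟩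
  obtain ⟨K, hK0, hK⟩ := exists_abs_integral_frozenBrk_sq_le hκ0 hκ hA hne hR0 hAR hδ0 hρ₀ hρ1 hα' hlam'
  exact ⟨K, hK0, fun u h ω N halive hBρ hδ hh0 hh hN0 hN hlamh ↦ hK halive hBρ hδ hh0 hh hN0 hN hlamh⟩

end Registered

end Summit.CriticalPhenomena.SAWScalingLimit.Theorems.SubseqIdentification.BoundaryAreaLaw

end
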